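import Mathlib
import Summits.CriticalPhenomena.PercolationContinuityZ3.Theorems.PercNearOneGluingNoHeavyLowerTailFirstUnitGluing
import HarnessLib

/-!
# `NoHeavyLowerTail` (stmt-CriticalPhenomena-4575) — FIRST-REACHING-UNIT GLUING, abstract form
# (arbitrary unit events: multi-attachment units, merged relay stars, …)

Support file (depth prover `prim-nh-dp-blobmono` gen 7, 2026-08-19; `--supports stmt-CriticalPhenomena-4575`).
No definitions, no named facts, no sorries.  Generalises `FirstUnitGluing.firstUnit_gluing` (units indexed by an attachment
vertex `x`, firing event `{s(o,x) open} ∩ R x`, failure event `{x ↮ b off o}`) to ARBITRARY units: an index set `K`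
(a finset of any type), firing events `U k` determined by pairwise disjoint finite pair sets `F k`, failure events `D k` with
the only structural requirement `U k ∖ D k ⊆ {o ↔ b}` ("a unit that fires and does not fail joins `o` to `b`"), honesty
`μ(U k ∩ D k) ≤ t·μ(U k)`, and the a.s. cover `{o ↔ A} ⊆ ⋃_k U k`.  Conclusion (`firstUnit_gluing_abstract`): for every
`θ > 0`, `μ({o ↔ A} ∩ {o ↮ b}) ≤ θ + t/θ`; proportional form (`firstUnit_gluing_abstract_prop`):
`≤ (t/θ + θ/(1−θ))·μ(⋃_k U k)` for `θ ∈ (0,1)`.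
USE: a Steiner unit attached to `o` at SEVERAL vertices (e.g. `o` on a Steiner cycle) is one unit whose firing event is
"some coin into the unit is open and the unit reaches a relay" and whose failure event is "no opened attachment vertex reaches
`b` off `o`"; all relay neighbours of `o` may be merged into ONE unit (failure = all opened relays miss `b` off `o`, honest with
modulus `t` trivially) — so they do not count towards the `θ`-bookkeeping.  The proof is the telescoping `FirstUnitGluing.sum_le_aux`
verbatim; only the inclusion step changes.
-/

namespace Summit.CriticalPhenomena.PercolationContinuityZ3.Theorems

open MeasureTheory Set
open Literature.Probability.LatticeModels (prodBernoulli)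
open Literature.Probability.Percolation

noncomputable section
open Classical

variable {n : ℕ}

namespace FirstUnitGluing


/-- **Telescoping lemma, general index type** (verbatim `FirstUnitGluing.sum_le_aux` with units indexed by a linearly
ordered type instead of `Fin n`). [this work] -/
theorem sum_le_aux_gen {κ : Type*} [LinearOrder κ] (w : Sym2 (Fin n) → unitInterval) (t θ : ℝ) (ht : 0 ≤ t)
    (hθ : 0 < θ) (K : Finset κ) (U D : κ → Set (BondConfig (Fin n))) (F : κ → Finset (Sym2 (Fin n)))
    (hdet : ∀ k ∈ K, DeterminedBy (U k) (↑(F k) : Set (Sym2 (Fin n))))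
    (hdisj : (↑K : Set κ).PairwiseDisjoint F)
    (hhon : ∀ k ∈ K, (prodBernoulli w).real (U k ∩ D k) ≤ t * (prodBernoulli w).real (U k)) :
    ∀ N₀ : Set (BondConfig (Fin n)), DeterminedBy N₀ (⋃ k ∈ K, (↑(F k) : Set (Sym2 (Fin n))))ᶜ →
      ∑ k ∈ K, (prodBernoulli w).real (U k ∩ D k ∩ (N₀ ∩ ⋂ k' ∈ K.filter (· < k), (U k')ᶜ)) ≤
        t / θ * ((prodBernoulli w).real N₀ - (prodBernoulli w).real (N₀ ∩ ⋂ k ∈ K, (U k)ᶜ)) +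
          (min ((prodBernoulli w).real N₀) θ -
            min ((prodBernoulli w).real (N₀ ∩ ⋂ k ∈ K, (U k)ᶜ)) θ) := by
  set μ := prodBernoulli w with hμ
  induction K using Finset.induction_on_min with
  | empty =>
    intro N₀ _
    simp
  | insert a s has ih =>
    intro N₀ hN₀
    have has' : a ∉ s := fun h => lt_irrefl a (has a h)
    have hdet' : ∀ k ∈ s, DeterminedBy (U k) (↑(F k) : Set (Sym2 (Fin n))) :=
      fun k hk => hdet k (Finset.mem_insert_of_mem hk)
    have hdisj' : (↑s : Set κ).PairwiseDisjoint F := hdisj.subset (by simp)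
    have hhon' : ∀ k ∈ s, μ.real (U k ∩ D k) ≤ t * μ.real (U k) :=
      fun k hk => hhon k (Finset.mem_insert_of_mem hk)
    have hFa : (↑(F a) : Set (Sym2 (Fin n))) ⊆ (⋃ k ∈ s, (↑(F k) : Set (Sym2 (Fin n))))ᶜ := by
      intro e he hes
      simp only [mem_iUnion, Finset.mem_coe, exists_prop] at hes
      obtain ⟨k, hk, hek⟩ := hes
      have hak : a ≠ k := fun h => has' (h ▸ hk)
      exact Finset.disjoint_left.1 (hdisj (Finset.mem_insert_self a s) (Finset.mem_insert_of_mem hk) hak) he hek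
    have hN₀s : DeterminedBy N₀ (⋃ k ∈ s, (↑(F k) : Set (Sym2 (Fin n))))ᶜ := by
      refine hN₀.mono (compl_subset_compl.2 ?_)
      intro e he
      simp only [mem_iUnion, Finset.mem_coe, exists_prop] at he ⊢
      obtain ⟨k, hk, hek⟩ := he
      exact ⟨k, Finset.mem_insert_of_mem hk, hek⟩
    have hN₀' : DeterminedBy (N₀ ∩ (U a)ᶜ) (⋃ k ∈ s, (↑(F k) : Set (Sym2 (Fin n))))ᶜ :=
      hN₀s.inter ((goodStep_determinedBy_compl (hdet a (Finset.mem_insert_self a s))).mono hFa)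
    have IH := ih hdet' hdisj' hhon' (N₀ ∩ (U a)ᶜ) hN₀'
    have hN₀a : DeterminedBy N₀ (↑(F a) : Set (Sym2 (Fin n)))ᶜ := by
      refine hN₀.mono (compl_subset_compl.2 ?_)
      intro e he
      simp only [mem_iUnion, Finset.mem_coe, exists_prop]
      exact ⟨a, Finset.mem_insert_self a s, he⟩
    have hind : μ.real (U a ∩ N₀) = μ.real (U a) * μ.real N₀ :=
      Literature.Probability.LatticeModels.prodBernoulli_real_inter_of_determinedBy w (F a)
        (hdet a (Finset.mem_insert_self a s)) hN₀a MeasurableSet.of_discrete MeasurableSet.of_discrete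
    have hsplit : μ.real (N₀ ∩ (U a)ᶜ) = μ.real N₀ * (1 - μ.real (U a)) := by
      have h := measureReal_inter_add_sdiff (μ := μ) (s := N₀) (t := U a) MeasurableSet.of_discrete
      rw [Set.sdiff_eq, inter_comm N₀ (U a), hind] at h
      linarith
    rw [Finset.sum_insert has']
    have hfa : (insert a s).filter (· < a) = ∅ := by
      refine Finset.filter_eq_empty_iff.2 fun y hy hya => ?_
      rcases Finset.mem_insert.1 hy with rfl | hy
      · exact lt_irrefl _ hya
      · exact lt_asymm hya (has y hy)
    have hterm_a : μ.real (U a ∩ D a ∩ (N₀ ∩ ⋂ y ∈ (insert a s).filter (· < a), (U y)ᶜ)) =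
        μ.real (U a ∩ D a ∩ N₀) := by
      rw [hfa]
      simp
    have hterm_s : ∀ x ∈ s, μ.real (U x ∩ D x ∩ (N₀ ∩ ⋂ y ∈ (insert a s).filter (· < x), (U y)ᶜ)) =
        μ.real (U x ∩ D x ∩ ((N₀ ∩ (U a)ᶜ) ∩ ⋂ y ∈ s.filter (· < x), (U y)ᶜ)) := by
      intro x hx
      have hfx : (insert a s).filter (· < x) = insert a (s.filter (· < x)) := by
        rw [Finset.filter_insert, if_pos (has x hx)]
      rw [hfx, Finset.set_biInter_insert]
      simp only [inter_assoc]
    rw [hterm_a, Finset.sum_congr rfl hterm_s]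
    have hu0 : 0 ≤ μ.real (U a) := measureReal_nonneg
    have hP0 : 0 ≤ μ.real N₀ := measureReal_nonneg
    have hm1 : μ.real (U a ∩ D a ∩ N₀) ≤ t * μ.real (U a) :=
      (measureReal_mono inter_subset_left (measure_ne_top _ _)).trans (hhon a (Finset.mem_insert_self a s))
    have hm2 : μ.real (U a ∩ D a ∩ N₀) ≤ μ.real (U a) * μ.real N₀ := by
      rw [← hind]
      exact measureReal_mono (fun ω hω => ⟨hω.1.1, hω.2⟩) (measure_ne_top _ _)
    have step := step_bound (m := μ.real (U a ∩ D a ∩ N₀)) hθ ht hu0 hP0 hm1 hm2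
    rw [← hsplit] at step
    have hfinal : N₀ ∩ (U a)ᶜ ∩ ⋂ x ∈ s, (U x)ᶜ = N₀ ∩ ⋂ x ∈ insert a s, (U x)ᶜ := by
      rw [Finset.set_biInter_insert, inter_assoc]
    rw [hfinal] at IH
    have e : t / θ * (μ.real N₀ - μ.real (N₀ ∩ (U a)ᶜ)) + (min (μ.real N₀) θ - min (μ.real (N₀ ∩ (U a)ᶜ)) θ) +
        (t / θ * (μ.real (N₀ ∩ (U a)ᶜ) - μ.real (N₀ ∩ ⋂ x ∈ insert a s, (U x)ᶜ)) +
          (min (μ.real (N₀ ∩ (U a)ᶜ)) θ - min (μ.real (N₀ ∩ ⋂ x ∈ insert a s, (U x)ᶜ)) θ)) =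
        t / θ * (μ.real N₀ - μ.real (N₀ ∩ ⋂ x ∈ insert a s, (U x)ᶜ)) +
          (min (μ.real N₀) θ - min (μ.real (N₀ ∩ ⋂ x ∈ insert a s, (U x)ᶜ)) θ) := by ring
    linarith [step, IH, e]

/-- **First-reaching-unit gluing, abstract units.**  `K` a finite index set with a linear order (any type with
`LinearOrder`, e.g. `Fin m` or the attachment vertices), firing events `U k` determined by pairwise disjoint finite pair
sets `F k`, failure events `D k` with `U k \ D k ⊆ {o ↔ b}`, honesty `μ(U k ∩ D k) ≤ t μ(U k)`, and
`μ({o ↔ A} \ ⋃_k U k) = 0`.  Then `μ({o ↔ A} ∩ {o ↮ b}) ≤ θ + t/θ` for every `θ > 0`. [this work] -/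
theorem firstUnit_gluing_abstract {κ : Type*} [LinearOrder κ] (w : Sym2 (Fin n) → unitInterval) (A : Finset (Fin n))
    (o b : Fin n) (K : Finset κ) (U D : κ → Set (BondConfig (Fin n))) (F : κ → Finset (Sym2 (Fin n)))
    (hdet : ∀ k ∈ K, DeterminedBy (U k) (↑(F k) : Set (Sym2 (Fin n))))
    (hdisj : (↑K : Set κ).PairwiseDisjoint F)
    (hUD : ∀ k ∈ K, U k \ D k ⊆ (openConn o b : Set (BondConfig (Fin n))))
    (t : ℝ) (ht : 0 ≤ t)
    (hhon : ∀ k ∈ K, (prodBernoulli w).real (U k ∩ D k) ≤ t * (prodBernoulli w).real (U k))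
    (hcov : (prodBernoulli w).real ((⋃ a ∈ A, (openConn o a : Set (BondConfig (Fin n)))) \ ⋃ k ∈ K, U k) = 0)
    (θ : ℝ) (hθ : 0 < θ) :
    (prodBernoulli w).real ((⋃ a ∈ A, (openConn o a : Set (BondConfig (Fin n)))) ∩ (openConn o b)ᶜ) ≤
      θ + t / θ := by
  set μ := prodBernoulli w with hμ
  set E₀ : Set (BondConfig (Fin n)) := ⋃ a ∈ A, (openConn o a : Set (BondConfig (Fin n))) with hE₀
  have hincl : E₀ ∩ (openConn o b)ᶜ ⊆ (E₀ \ ⋃ k ∈ K, U k) ∪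
      ⋃ k ∈ K, (U k ∩ D k ∩ (univ ∩ ⋂ k' ∈ K.filter (· < k), (U k')ᶜ)) := by
    intro ω hω
    by_cases hex : ω ∈ ⋃ k ∈ K, U k
    · right
      simp only [mem_iUnion, exists_prop] at hex
      obtain ⟨k₁, hk₁K, hk₁U⟩ := hex
      set S : Finset κ := K.filter (fun k => ω ∈ U k) with hS
      have hSne : S.Nonempty := ⟨k₁, Finset.mem_filter.2 ⟨hk₁K, hk₁U⟩⟩
      set k₀ := S.min' hSne with hk₀
      have hk₀S : k₀ ∈ S := Finset.min'_mem S hSne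
      have hk₀K : k₀ ∈ K := (Finset.mem_filter.1 hk₀S).1
      have hk₀U : ω ∈ U k₀ := (Finset.mem_filter.1 hk₀S).2
      simp only [mem_iUnion, exists_prop]
      refine ⟨k₀, hk₀K, ⟨⟨hk₀U, ?_⟩, mem_univ _, ?_⟩⟩
      · by_contra hD
        exact hω.2 (hUD k₀ hk₀K ⟨hk₀U, hD⟩)
      · simp only [mem_iInter]
        intro k hk hkU
        have hkS : k ∈ S := Finset.mem_filter.2 ⟨(Finset.mem_filter.1 hk).1, hkU⟩
        exact absurd (Finset.mem_filter.1 hk).2 (not_lt.2 (Finset.min'_le S k hkS))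
    · left
      exact ⟨hω.1, hex⟩
  have hs := sum_le_aux_gen w t θ ht hθ K U D F hdet hdisj hhon univ (determinedBy_univ _)
  have h1 : μ.real (E₀ ∩ (openConn o b)ᶜ) ≤ μ.real (E₀ \ ⋃ k ∈ K, U k) +
      μ.real (⋃ k ∈ K, (U k ∩ D k ∩ (univ ∩ ⋂ k' ∈ K.filter (· < k), (U k')ᶜ))) :=
    (measureReal_mono hincl (measure_ne_top _ _)).trans (measureReal_union_le _ _)
  have h2 : μ.real (⋃ k ∈ K, (U k ∩ D k ∩ (univ ∩ ⋂ k' ∈ K.filter (· < k), (U k')ᶜ))) ≤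
      ∑ k ∈ K, μ.real (U k ∩ D k ∩ (univ ∩ ⋂ k' ∈ K.filter (· < k), (U k')ᶜ)) :=
    measureReal_biUnion_finset_le _ _
  have h3 : μ.real (E₀ \ ⋃ k ∈ K, U k) = 0 := hcov
  have huniv : μ.real (univ : Set (BondConfig (Fin n))) = 1 := probReal_univ
  have hq0 : 0 ≤ μ.real (univ ∩ ⋂ k ∈ K, (U k)ᶜ) := measureReal_nonneg
  have hq1 : 0 ≤ min (μ.real (univ ∩ ⋂ k ∈ K, (U k)ᶜ)) θ := le_min hq0 hθ.le
  have hm1 : min (μ.real (univ : Set (BondConfig (Fin n)))) θ ≤ θ := min_le_right _ _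
  have htθ : 0 ≤ t / θ := div_nonneg ht hθ.le
  have h4 : t / θ * (μ.real (univ : Set (BondConfig (Fin n))) - μ.real (univ ∩ ⋂ k ∈ K, (U k)ᶜ)) ≤ t / θ := by
    rw [huniv]
    have : 1 - μ.real (univ ∩ ⋂ k ∈ K, (U k)ᶜ) ≤ 1 := by linarith
    calc t / θ * (1 - μ.real (univ ∩ ⋂ k ∈ K, (U k)ᶜ)) ≤ t / θ * 1 := mul_le_mul_of_nonneg_left this htθ
      _ = t / θ := mul_one _
  linarith [h1, h2, h3, hs, h4, hq1, hm1]

/-- **First-reaching-unit gluing, abstract units, proportional form**: under the hypotheses of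
`firstUnit_gluing_abstract`, for `θ ∈ (0,1)`:  `μ({o ↔ A} ∩ {o ↮ b}) ≤ (t/θ + θ/(1−θ)) · μ(⋃_k U k)`. [this work] -/
theorem firstUnit_gluing_abstract_prop {κ : Type*} [LinearOrder κ] (w : Sym2 (Fin n) → unitInterval)
    (A : Finset (Fin n)) (o b : Fin n) (K : Finset κ) (U D : κ → Set (BondConfig (Fin n)))
    (F : κ → Finset (Sym2 (Fin n)))
    (hdet : ∀ k ∈ K, DeterminedBy (U k) (↑(F k) : Set (Sym2 (Fin n))))
    (hdisj : (↑K : Set κ).PairwiseDisjoint F)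
    (hUD : ∀ k ∈ K, U k \ D k ⊆ (openConn o b : Set (BondConfig (Fin n))))
    (t : ℝ) (ht : 0 ≤ t)
    (hhon : ∀ k ∈ K, (prodBernoulli w).real (U k ∩ D k) ≤ t * (prodBernoulli w).real (U k))
    (hcov : (prodBernoulli w).real ((⋃ a ∈ A, (openConn o a : Set (BondConfig (Fin n)))) \ ⋃ k ∈ K, U k) = 0)
    (θ : ℝ) (hθ : 0 < θ) (hθ1 : θ < 1) :
    (prodBernoulli w).real ((⋃ a ∈ A, (openConn o a : Set (BondConfig (Fin n)))) ∩ (openConn o b)ᶜ) ≤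
      (t / θ + θ / (1 - θ)) * (prodBernoulli w).real (⋃ k ∈ K, U k) := by
  set μ := prodBernoulli w with hμ
  set E₀ : Set (BondConfig (Fin n)) := ⋃ a ∈ A, (openConn o a : Set (BondConfig (Fin n))) with hE₀
  have hincl : E₀ ∩ (openConn o b)ᶜ ⊆ (E₀ \ ⋃ k ∈ K, U k) ∪
      ⋃ k ∈ K, (U k ∩ D k ∩ (univ ∩ ⋂ k' ∈ K.filter (· < k), (U k')ᶜ)) := by
    intro ω hω
    by_cases hex : ω ∈ ⋃ k ∈ K, U k
    · right
      simp only [mem_iUnion, exists_prop] at hex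
      obtain ⟨k₁, hk₁K, hk₁U⟩ := hex
      set S : Finset κ := K.filter (fun k => ω ∈ U k) with hS
      have hSne : S.Nonempty := ⟨k₁, Finset.mem_filter.2 ⟨hk₁K, hk₁U⟩⟩
      set k₀ := S.min' hSne with hk₀
      have hk₀S : k₀ ∈ S := Finset.min'_mem S hSne
      have hk₀K : k₀ ∈ K := (Finset.mem_filter.1 hk₀S).1
      have hk₀U : ω ∈ U k₀ := (Finset.mem_filter.1 hk₀S).2
      simp only [mem_iUnion, exists_prop]
      refine ⟨k₀, hk₀K, ⟨⟨hk₀U, ?_⟩, mem_univ _, ?_⟩⟩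
      · by_contra hD
        exact hω.2 (hUD k₀ hk₀K ⟨hk₀U, hD⟩)
      · simp only [mem_iInter]
        intro k hk hkU
        have hkS : k ∈ S := Finset.mem_filter.2 ⟨(Finset.mem_filter.1 hk).1, hkU⟩
        exact absurd (Finset.mem_filter.1 hk).2 (not_lt.2 (Finset.min'_le S k hkS))
    · left
      exact ⟨hω.1, hex⟩
  have hsum := sum_le_aux_gen w t θ ht hθ K U D F hdet hdisj hhon univ (determinedBy_univ _)
  have h1 : μ.real (E₀ ∩ (openConn o b)ᶜ) ≤ μ.real (E₀ \ ⋃ k ∈ K, U k) +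
      μ.real (⋃ k ∈ K, (U k ∩ D k ∩ (univ ∩ ⋂ k' ∈ K.filter (· < k), (U k')ᶜ))) :=
    (measureReal_mono hincl (measure_ne_top _ _)).trans (measureReal_union_le _ _)
  have h2 : μ.real (⋃ k ∈ K, (U k ∩ D k ∩ (univ ∩ ⋂ k' ∈ K.filter (· < k), (U k')ᶜ))) ≤
      ∑ k ∈ K, μ.real (U k ∩ D k ∩ (univ ∩ ⋂ k' ∈ K.filter (· < k), (U k')ᶜ)) :=
    measureReal_biUnion_finset_le _ _
  have h3 : μ.real (E₀ \ ⋃ k ∈ K, U k) = 0 := hcov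
  set ρ := μ.real (⋃ k ∈ K, U k) with hρ
  have hP : μ.real (univ ∩ ⋂ k ∈ K, (U k)ᶜ) = 1 - ρ := by
    have hc : (univ ∩ ⋂ k ∈ K, (U k)ᶜ) = (⋃ k ∈ K, U k)ᶜ := by
      rw [univ_inter, compl_iUnion₂]
    rw [hc, measureReal_compl MeasurableSet.of_discrete, probReal_univ]
  have huniv : μ.real (univ : Set (BondConfig (Fin n))) = 1 := probReal_univ
  rw [hP, huniv] at hsum
  have hρ0 : 0 ≤ ρ := measureReal_nonneg
  have hρ1 : ρ ≤ 1 := measureReal_le_one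
  have hθ' : 0 ≤ θ / (1 - θ) := div_nonneg hθ.le (by linarith)
  have hmin1 : min (1 : ℝ) θ = θ := min_eq_right hθ1.le
  rw [hmin1] at hsum
  have hsecond : θ - min (1 - ρ) θ ≤ θ / (1 - θ) * ρ := by
    by_cases hcase : θ ≤ 1 - ρ
    · rw [min_eq_right hcase, sub_self]
      exact mul_nonneg hθ' hρ0
    · push Not at hcase
      rw [min_eq_left hcase.le]
      rw [div_mul_eq_mul_div, le_div_iff₀ (by linarith)]
      nlinarith [hρ1, hθ.le, hθ1]
  have : t / θ * (1 - (1 - ρ)) = t / θ * ρ := by ring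
  rw [this] at hsum
  calc μ.real (E₀ ∩ (openConn o b)ᶜ)
      ≤ 0 + ∑ k ∈ K, μ.real (U k ∩ D k ∩ (univ ∩ ⋂ k' ∈ K.filter (· < k), (U k')ᶜ)) := by linarith
    _ ≤ t / θ * ρ + (θ - min (1 - ρ) θ) := by linarith
    _ ≤ t / θ * ρ + θ / (1 - θ) * ρ := by linarith
    _ = (t / θ + θ / (1 - θ)) * ρ := by ring

end FirstUnitGluing

end

end Summit.CriticalPhenomena.PercolationContinuityZ3.Theorems
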